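import Summits.Schanuel.Schanuel.Theorems.RootDecomp1KSkelCell08

/-!
# RootDecomp1KSkelCell — lens 1, generations 43–44 «THE QUALITY-ONLY CLASS SkelLiouville ⊋ LogLogLiouville AND ITS CERTIFIED MEMBER ρ⋆» (PRICE K-α L2033, CLAIM L2045, ACK L2046; (α) PROPER of the 1K wall map): the location-free class `SkelLiouville ρ := ∀ m ∃ r, m ≤ den r ∧ ρ ≠ r ∧ |ρ − r| < den^{−m·ι(den)}` (ι q = least N with q ≤ 2^{N!}) with `LogLogLiouville ⊊ SkelLiouville ⊆ Liouville` PROVED, the member ρ⋆ = Σ_j 2^{−2^{e_j}} (FREDHOLM SERIES WITH DELETED BLOCKS) certified HYPOTHESIS-FREE in Skel ∖ (LogLog ∪ FactorialGap), the SKEL engine + extraction, the walls (1, ℓ₂, ρ) mod hNW / π-twins and the pair (ℓ₂, ρ) HYPOTHESIS-FREE for every ρ ∈ Skel, the items APPLIED at z⋆ with all binders discharged, the m = 1 ceiling, and §9 hNW DISCHARGED BY NAME on the e-wall via the Literature proof module — continuation (RootDecomp1KSkelCell09): §7b member tuples, scope certificates, items at the members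

(lens-1 g43/g44 HOME kernel SkelCell.lean EDITION 2 b7163857…, 2822 l, imports tree RootDecomp1KGapCell01 (+ for §9 only Literature ExpOneTranscendenceMeasureProofs); CLAIM L2045, ACK L2046 (CHECKLIST K-α (1)–(8) + the constant-dependence line of L2085 (R4)), NODE L2132 / REQUEST L2133, critic VERDICT L2140 (crit g9: CLEARED — ONE CELL credit (K-α); lens-1 tally credits ×11 + THEOREM; PORT GO in substance 01–0k `--supports stmt-Schanuel-33364`, the two scoped heartbeat raises flagged for the port record, addendum D as RootDecomp1KNWMeasureHolds GO LOW); port by census-1 gen 18 as `RootDecomp1KSkelCell01`–`11` along K's sections: 01 = §1 `iota`, `SkelLiouville`, inclusions `SkelLiouville.liouville` / `logLogLiouville_skelLiouville`; 02 = §5a anchors `aI`/`sI` + §5b the skeleton `eS`, positions `cS`, terms `aS` (up to `summable_aS`); 03 = §5b the member `rhoStar`, truncations `tS`/`rS`, bounds + §6 covering / quality lemmas; 04 = §6 THE MEMBER THEOREMS `skelLiouville_rhoStar`, `not_logLogLiouville_rhoStar`, `not_factorialGapLiouville_rhoStar`, `liouville_rhoStar`, `not_skelLiouville_subset_logLogLiouville`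 + §2 engine preliminaries (`SkelMeasure`, `exists_scale_index_iota`); 05 = §2 THE ENGINE `skelMeasure_cons_liouvilleNumber` (scoped `maxHeartbeats 800000` as in K) + `SkelMeasure.mvWeakMeasure`; 06 = §3 EXTRACTION `no_int_relation_of_skelMeasure_skelLiouville`, `sb_of_skelLiouville_of_skelMeasure`; 07 = §4 THE CELLS (pair hyp-free, walls mod hNW, π-twins) + the live items in item shape; 08 = §7 three interlaced cuts `deletedBlock_margins`, `form_lower_bound_S` (scoped `maxHeartbeats 1600000`); 09 = §7b member tuples zS2/zS3/zS3pi, scope certificates, items AT the members; 10 = §8 the fixed-multiple ladder and the m = 1 ceiling (`uStar`, `skel_fixedOne_ceiling`); 11 = §9 hNW DISCHARGED BY NAME (imports Literature ExpOneTranscendenceMeasureProofs).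
PORT EDITS: `set_option linter.dupNamespace false` dropped; the Literature import moved from the head to part 11 (the only user); K's 13 private helpers travel as per-part private copies; two generic helpers made `private` after the dedup bounce of 02 (p829539: `two_mul_le_two_pow` ≡ Literature.NumberTheory.EllipticCurves.two_mul_le_two_pow; also `log_two_lt_self` pre-emptively) and of 03 (p829791: `one_le_loglog` ≡ Literature Tao2016.EntropyDecrement.one_le_log_log; then nine more generic arithmetic helpers privatised pre-emptively: loglog_pow_pow_ge, add_factorial_mul_le_factorial_add, one_lt_ell2, partialSum_two_two, five_fourths_le_partialSum, ell2_lt, psNumer_two_cast, two_pow_lt_psNumer); and of 07 (p830787: the read-back `sb_logLogWall3_via_skel` ≡ tree `RootDecomp1KLogLogCell.sb_logLogCell` → private; in §9 likewise `nwMeasure_holds` and `sb_logLogWall3_via_skel'`, whose statements coincide with the census port RootDecomp1KNWMeasureHolds — `nwMeasure_holds` / `polyMeasure_exp_one_holds` / `sb_logLogCell'` there); and of 09 (p831465: the gate's dedup lint equates `algebraicIndependent_ell2_rhoStar : AlgebraicIndependent ℚ ![ℓ₂, ρ⋆]` with GapCell06's `algebraicIndependent_ell2_rhoW` (same shape, different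 member constant) — made `private` to pass; the public pair certificates `linearIndependent_zS2` / `sb_zS2` / `coordLiouvilleSchanuel_at_zS2` carry the content); statements and proofs verbatim. `--supports stmt-Schanuel-33364`; no census credit carried; rung 0 — nothing here proves Schanuel.)
-/

open Summit.Schanuel.Schanuel.Theorems.RootDecomp1KHyper
open Summit.Schanuel.Schanuel.Theorems.RootDecomp1KHyper.HyperCell
open Summit.Schanuel.Schanuel.Theorems.RootDecomp1KGeneric
open Summit.Schanuel.Schanuel.Theorems.RootDecomp1KRelLiouvilleCell
open Summit.Schanuel.Schanuel.Theorems.RootDecomp1KLogLogCell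
open Summit.Schanuel.Schanuel.Theorems.RootDecomp1KTwoBaseCell
open Summit.Schanuel.Schanuel.Theorems.RootDecomp1KGapCell
open LiouvilleNumber
open scoped Nat

namespace Summit.Schanuel.Schanuel.Theorems.RootDecomp1KSkelCell

/-! ## §7b  THE MEMBER TUPLES `z⋆₂ = (ℓ₂, ρ⋆)`, `z⋆₃ = (1, ℓ₂, ρ⋆)`, `z⋆₃^π = (π, πℓ₂, πρ⋆)` — scope certificates
(ALL hypothesis-free) and the live items 33364 / 31077 APPLIED at them -/

section Certificates
open IntermediateField

/-- `(1, u⃗)` is ℚ-linearly independent when `u⃗` is algebraically independent over `ℚ`. -/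
private theorem linearIndependent_one_cons_of_algebraicIndependent {m : ℕ} {u : Fin m → ℂ}
    (hu : AlgebraicIndependent ℚ u) : LinearIndependent ℚ (Fin.cons (1 : ℂ) u : Fin (m + 1) → ℂ) := by
  classical
  rw [linearIndependent_finCons]
  refine ⟨hu.linearIndependent, fun hmem => ?_⟩
  obtain ⟨c, hc⟩ := (Submodule.mem_span_range_iff_exists_fun (R := ℚ)).mp hmem
  set P : MvPolynomial (Fin m) ℚ := ∑ i, MvPolynomial.C (c i) * MvPolynomial.X i - 1 with hP
  have hval : MvPolynomial.aeval u P = 0 := by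
    simp only [hP, map_sub, map_sum, map_mul, MvPolynomial.aeval_C, MvPolynomial.aeval_X, map_one]
    rw [← hc]
    simp [Algebra.smul_def]
  have hP0 : P = 0 :=
    (algebraicIndependent_iff_injective_aeval.mp hu) (by rw [hval, map_zero])
  have hcc : MvPolynomial.constantCoeff P = -1 := by
    simp [hP, MvPolynomial.constantCoeff_X]
  rw [hP0, map_zero] at hcc
  norm_num at hcc

/-- Scaling by `π ≠ 0` preserves ℚ-linear independence. -/
private theorem linearIndependent_pi_mul {N : ℕ} {v : Fin N → ℂ} (hv : LinearIndependent ℚ v) :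
    LinearIndependent ℚ (fun i => (Real.pi : ℂ) * v i) := by
  rw [Fintype.linearIndependent_iff] at hv ⊢
  intro g hg
  apply hv g
  have hπ0 : (Real.pi : ℂ) ≠ 0 := by exact_mod_cast Real.pi_ne_zero
  have h : (Real.pi : ℂ) * ∑ i, g i • v i = 0 := by
    rw [Finset.mul_sum]
    calc ∑ i, (Real.pi : ℂ) * (g i • v i) = ∑ i, g i • ((Real.pi : ℂ) * v i) :=
          Finset.sum_congr rfl fun i _ => by rw [mul_smul_comm]
      _ = 0 := hg
  exact (mul_eq_zero.mp h).resolve_left hπ0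

/-- **`(ℓ₂, ρ)` is algebraically independent over `ℚ` for EVERY Skel-Liouville `ρ`** — HYPOTHESIS-FREE
(engine §2 at `n = 0` + extraction §3). -/
theorem algebraicIndependent_ell2_of_skelLiouville {ρ : ℝ} (hρ : SkelLiouville ρ) :
    AlgebraicIndependent ℚ ![((liouvilleNumber 2 : ℝ) : ℂ), (ρ : ℂ)] := by
  have h := algebraicIndependent_option_of_skelMeasure_skelLiouville skelMeasure_liouvilleNumber hρ
  have e : (![((liouvilleNumber 2 : ℝ) : ℂ), (ρ : ℂ)] : Fin 2 → ℂ) =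
      (fun o : Option (Fin 1) => o.elim (ρ : ℂ)
        (Fin.cons ((liouvilleNumber 2 : ℝ) : ℂ) Fin.elim0 : Fin 1 → ℂ)) ∘
        (![some 0, none] : Fin 2 → Option (Fin 1)) := by
    funext i; fin_cases i <;> simp
  rw [e]
  exact h.comp _ (by decide)

/-- `(ℓ₂, ρ⋆)` is algebraically independent over `ℚ` — HYPOTHESIS-FREE. -/
private theorem algebraicIndependent_ell2_rhoStar :
    AlgebraicIndependent ℚ ![((liouvilleNumber 2 : ℝ) : ℂ), (rhoStar : ℂ)] :=
  algebraicIndependent_ell2_of_skelLiouville skelLiouville_rhoStar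

/-- THE MEMBERS. `z⋆₂ = (ℓ₂, ρ⋆)`. -/
noncomputable def zS2 : Fin 2 → ℂ := ![((liouvilleNumber 2 : ℝ) : ℂ), (rhoStar : ℂ)]
/-- `z⋆₃ = (1, ℓ₂, ρ⋆)`. -/
noncomputable def zS3 : Fin 3 → ℂ := ![(1 : ℂ), ((liouvilleNumber 2 : ℝ) : ℂ), (rhoStar : ℂ)]
/-- `z⋆₃^π = (π, πℓ₂, πρ⋆)`. -/
noncomputable def zS3pi : Fin 3 → ℂ :=
  ![(Real.pi : ℂ), (Real.pi : ℂ) * ((liouvilleNumber 2 : ℝ) : ℂ), (Real.pi : ℂ) * (rhoStar : ℂ)]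

/-- (i) ℚ-linear independence — HYPOTHESIS-FREE. -/
theorem linearIndependent_zS2 : LinearIndependent ℚ zS2 := algebraicIndependent_ell2_rhoStar.linearIndependent

/-- `LinearIndependent ℚ zS3`. -/
theorem linearIndependent_zS3 : LinearIndependent ℚ zS3 := by
  have e : zS3 = (Fin.cons (1 : ℂ) ![((liouvilleNumber 2 : ℝ) : ℂ), (rhoStar : ℂ)] : Fin 3 → ℂ) := by
    funext i; fin_cases i <;> simp [zS3]
  rw [e]; exact linearIndependent_one_cons_of_algebraicIndependent algebraicIndependent_ell2_rhoStar

/-- `LinearIndependent ℚ zS3pi`. -/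
theorem linearIndependent_zS3pi : LinearIndependent ℚ zS3pi := by
  have e : zS3pi = fun i => (Real.pi : ℂ) * zS3 i := by
    funext i; fin_cases i <;> simp [zS3pi, zS3]
  rw [e]; exact linearIndependent_pi_mul linearIndependent_zS3

/-- (ii) Liouville to every polynomial order as linear forms (through the prefix `(1, ℓ₂)`). -/
theorem linLiouville_zS3 : LinLiouville zS3 := by
  have hℓ : Liouville (liouvilleNumber 2) := liouville_liouvilleNumber (le_refl 2)
  refine linLiouville_of_prefix (k := 2) (n := 3) (by norm_num) ?_
  have h2 : (fun i : Fin 2 => zS3 (Fin.castLE (show 2 ≤ 3 by norm_num) i)) =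
      ![(1 : ℂ), ((liouvilleNumber 2 : ℝ) : ℂ) * 1] := by
    funext i; fin_cases i <;> simp [zS3]
  rw [h2]
  exact linLiouville_of_liouville_ratio hℓ 1

/-- `LinLiouville zS3pi` (through the prefix `(π, πℓ₂)`). -/
theorem linLiouville_zS3pi : LinLiouville zS3pi := by
  have hℓ : Liouville (liouvilleNumber 2) := liouville_liouvilleNumber (le_refl 2)
  refine linLiouville_of_prefix (k := 2) (n := 3) (by norm_num) ?_
  have h2 : (fun i : Fin 2 => zS3pi (Fin.castLE (show 2 ≤ 3 by norm_num) i)) =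
      ![(Real.pi : ℂ), ((liouvilleNumber 2 : ℝ) : ℂ) * (Real.pi : ℂ)] := by
    funext i; fin_cases i <;> simp [zS3pi, mul_comm]
  rw [h2]
  exact linLiouville_of_liouville_ratio hℓ (Real.pi : ℂ)

/-- (iii) the scope of 31077: a span element with a Liouville coordinate — two kinds: `ρ⋆` (Skel, hence Liouville)
and `ℓ₂`. -/
theorem coordLiouvilleSpan_zS2 : ∃ w ∈ Submodule.span ℚ (Set.range zS2), Liouville w.re ∨ Liouville w.im :=
  ⟨zS2 1, Submodule.subset_span ⟨1, rfl⟩, Or.inl (by simpa [zS2] using liouville_rhoStar)⟩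

/-- the `ℓ₂`-coordinate variant. -/
theorem coordLiouvilleSpan_zS2' : ∃ w ∈ Submodule.span ℚ (Set.range zS2), Liouville w.re ∨ Liouville w.im := by
  have hℓ : Liouville (liouvilleNumber 2) := liouville_liouvilleNumber (le_refl 2)
  exact ⟨zS2 0, Submodule.subset_span ⟨0, rfl⟩, Or.inl (by simpa [zS2] using hℓ)⟩

/-- `∃ w ∈ Submodule.span ℚ (Set.range zS3), Liouville w.re ∨ Liouville w.im`. -/
theorem coordLiouvilleSpan_zS3 : ∃ w ∈ Submodule.span ℚ (Set.range zS3), Liouville w.re ∨ Liouville w.im :=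
  ⟨zS3 2, Submodule.subset_span ⟨2, rfl⟩, Or.inl (by simpa [zS3] using liouville_rhoStar)⟩

/-- (iv) Schanuel's bound AT THE MEMBERS: the pair and the π-twin HYPOTHESIS-FREE, the e-wall mod `hNW`. -/
theorem sb_zS2 : SB 2 zS2 := sb_skelPair skelLiouville_rhoStar
/-- `SB 3 zS3` (mod `hNW`). -/
theorem sb_zS3 (hNW : NWMeasure) : SB 3 zS3 := sb_skelWall3 hNW skelLiouville_rhoStar
/-- `SB 3 zS3pi` — HYPOTHESIS-FREE. -/
theorem sb_zS3pi : SB 3 zS3pi := sb_skelWall3_pi skelLiouville_rhoStar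

/-- An integer form in `z⋆₃` is the real number `g₀ + g₁ ℓ₂ + g₂ ρ⋆`. -/
theorem zS3_form (g : Fin 3 → ℤ) :
    ∑ i, (g i : ℂ) * zS3 i = (((g 0 : ℝ) + g 1 * liouvilleNumber 2 + g 2 * rhoStar : ℝ) : ℂ) := by
  rw [Fin.sum_univ_three]
  simp only [zS3, Matrix.cons_val_zero, Matrix.cons_val_one, Matrix.cons_val_two, Matrix.head_cons,
    Matrix.tail_cons]
  push_cast; ring

/-- `∑ i, (g i : ℂ) * zS3pi i = π · (g₀ + g₁ ℓ₂ + g₂ ρ⋆)`. -/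
theorem zS3pi_form (g : Fin 3 → ℤ) :
    ∑ i, (g i : ℂ) * zS3pi i =
      (Real.pi : ℂ) * (((g 0 : ℝ) + g 1 * liouvilleNumber 2 + g 2 * rhoStar : ℝ) : ℂ) := by
  rw [Fin.sum_univ_three]
  simp only [zS3pi, Matrix.cons_val_zero, Matrix.cons_val_one, Matrix.cons_val_two, Matrix.head_cons,
    Matrix.tail_cons]
  push_cast; ring

/-- `‖∑ i, (g i : ℂ) * zS3 i‖ = |g₀ + g₁ ℓ₂ + g₂ ρ⋆|`. -/
theorem norm_zS3_form (g : Fin 3 → ℤ) :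
    ‖∑ i, (g i : ℂ) * zS3 i‖ = |(g 0 : ℝ) + g 1 * liouvilleNumber 2 + g 2 * rhoStar| := by
  rw [zS3_form, Complex.norm_real, Real.norm_eq_abs]

/-- `‖∑ i, (g i : ℂ) * zS3pi i‖ = π · |g₀ + g₁ ℓ₂ + g₂ ρ⋆|`. -/
theorem norm_zS3pi_form (g : Fin 3 → ℤ) :
    ‖∑ i, (g i : ℂ) * zS3pi i‖ = Real.pi * |(g 0 : ℝ) + g 1 * liouvilleNumber 2 + g 2 * rhoStar| := by
  rw [zS3pi_form, norm_mul, Complex.norm_real, Complex.norm_real, Real.norm_eq_abs, Real.norm_eq_abs,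
    abs_of_pos Real.pi_pos]

/-- **(v) `z⋆₃` has NO hyper-small integer forms** (three cuts at a deleted block; hypothesis-free). -/
theorem not_hyperLinLiouville_zS3 : ¬ HyperLinLiouville zS3 := by
  intro hH
  obtain ⟨g, hg, hlt⟩ := hH 86
  rw [norm_zS3_form] at hlt
  have hlow := form_lower_bound_S g hg
  have hX : (1 : ℝ) ≤ 1 + ∑ i, (|g i| : ℝ) := by
    have : (0 : ℝ) ≤ ∑ i, (|g i| : ℝ) :=
      Finset.sum_nonneg fun i _ => by exact_mod_cast abs_nonneg (g i)
    linarith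
  have hmono : (1 + ∑ i, (|g i| : ℝ)) ^ 85 ≤ (1 + ∑ i, (|g i| : ℝ)) ^ 86 :=
    pow_le_pow_right₀ hX (by norm_num)
  have := Real.exp_le_exp.mpr (neg_le_neg hmono)
  linarith

/-- **(v^π) `z⋆₃^π` has NO hyper-small integer forms** (hypothesis-free). -/
theorem not_hyperLinLiouville_zS3pi : ¬ HyperLinLiouville zS3pi := by
  intro hH
  obtain ⟨g, hg, hlt⟩ := hH 86
  rw [norm_zS3pi_form] at hlt
  have hlow := form_lower_bound_S g hg
  have hX : (1 : ℝ) ≤ 1 + ∑ i, (|g i| : ℝ) := by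
    have : (0 : ℝ) ≤ ∑ i, (|g i| : ℝ) :=
      Finset.sum_nonneg fun i _ => by exact_mod_cast abs_nonneg (g i)
    linarith
  have hmono : (1 + ∑ i, (|g i| : ℝ)) ^ 85 ≤ (1 + ∑ i, (|g i| : ℝ)) ^ 86 :=
    pow_le_pow_right₀ hX (by norm_num)
  have := Real.exp_le_exp.mpr (neg_le_neg hmono)
  have hπ : (1 : ℝ) ≤ Real.pi := by have := Real.pi_gt_three; linarith
  have habs := abs_nonneg ((g 0 : ℝ) + g 1 * liouvilleNumber 2 + g 2 * rhoStar)
  nlinarith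

/-- **`z⋆₃` lies in the scope of item 33364** — all three hypotheses, HYPOTHESIS-FREE (text of the binders). -/
theorem zS3_in_scope_33364 :
    LinearIndependent ℚ zS3 ∧
    (∀ ω : ℕ, ∃ h : Fin 3 → ℤ, h ≠ 0 ∧ ‖∑ i, (h i : ℂ) * zS3 i‖ < 1 / (1 + ∑ i, (|h i| : ℝ)) ^ ω) ∧
    (¬ ∀ m : ℕ, ∃ h : Fin 3 → ℤ, h ≠ 0 ∧
      ‖∑ i, (h i : ℂ) * zS3 i‖ < Real.exp (-((1 + ∑ i, (|h i| : ℝ)) ^ m))) :=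
  ⟨linearIndependent_zS3, linLiouville_zS3, not_hyperLinLiouville_zS3⟩

/-- `z⋆₃^π` lies in the scope of item 33364 — HYPOTHESIS-FREE. -/
theorem zS3pi_in_scope_33364 :
    LinearIndependent ℚ zS3pi ∧
    (∀ ω : ℕ, ∃ h : Fin 3 → ℤ, h ≠ 0 ∧ ‖∑ i, (h i : ℂ) * zS3pi i‖ < 1 / (1 + ∑ i, (|h i| : ℝ)) ^ ω) ∧
    (¬ ∀ m : ℕ, ∃ h : Fin 3 → ℤ, h ≠ 0 ∧
      ‖∑ i, (h i : ℂ) * zS3pi i‖ < Real.exp (-((1 + ∑ i, (|h i| : ℝ)) ^ m))) :=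
  ⟨linearIndependent_zS3pi, linLiouville_zS3pi, not_hyperLinLiouville_zS3pi⟩

/-- `z⋆₂` lies in the scope of item 31077 — HYPOTHESIS-FREE. -/
theorem zS2_in_scope_31077 :
    LinearIndependent ℚ zS2 ∧ (∃ w ∈ Submodule.span ℚ (Set.range zS2), Liouville w.re ∨ Liouville w.im) :=
  ⟨linearIndependent_zS2, coordLiouvilleSpan_zS2⟩

/-- **ITEM 33364 DECIDED AT `z⋆₃`** (mod `hNW`): scope (i)–(iii) hypothesis-free AND the conclusion. -/
theorem finiteOrderLiouvilleSchanuel_at_zS3 (hNW : NWMeasure) :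
    LinearIndependent ℚ zS3 ∧ LinLiouville zS3 ∧ ¬ HyperLinLiouville zS3 ∧ SB 3 zS3 :=
  ⟨linearIndependent_zS3, linLiouville_zS3, not_hyperLinLiouville_zS3, sb_zS3 hNW⟩

/-- **ITEM 33364 DECIDED AT `z⋆₃^π` — HYPOTHESIS-FREE.** -/
theorem finiteOrderLiouvilleSchanuel_at_zS3pi :
    LinearIndependent ℚ zS3pi ∧ LinLiouville zS3pi ∧ ¬ HyperLinLiouville zS3pi ∧ SB 3 zS3pi :=
  ⟨linearIndependent_zS3pi, linLiouville_zS3pi, not_hyperLinLiouville_zS3pi, sb_zS3pi⟩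

/-- **ITEM 31077 DECIDED AT THE PAIR `z⋆₂` — HYPOTHESIS-FREE** (scope AND conclusion). -/
theorem coordLiouvilleSchanuel_at_zS2 :
    LinearIndependent ℚ zS2 ∧ (∃ w ∈ Submodule.span ℚ (Set.range zS2), Liouville w.re ∨ Liouville w.im) ∧
      SB 2 zS2 :=
  ⟨linearIndependent_zS2, coordLiouvilleSpan_zS2, sb_zS2⟩

/-- **THE LIVE ITEM 33364 APPLIED at `z⋆₃`** (its text as a hypothesis; the member discharges all binders). -/
theorem item33364_at_zS3
    (h33364 : ∀ (n : ℕ) (z : Fin n → ℂ), LinearIndependent ℚ z →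
      (∀ ω : ℕ, ∃ h : Fin n → ℤ, h ≠ 0 ∧ ‖∑ i, (h i : ℂ) * z i‖ < 1 / (1 + ∑ i, (|h i| : ℝ)) ^ ω) →
      (¬ ∀ m : ℕ, ∃ h : Fin n → ℤ, h ≠ 0 ∧
        ‖∑ i, (h i : ℂ) * z i‖ < Real.exp (-((1 + ∑ i, (|h i| : ℝ)) ^ m))) →
      (n : Cardinal) ≤ Algebra.trdeg ℚ
        ↥(IntermediateField.adjoin ℚ (Set.range z ∪ Set.range (Complex.exp ∘ z)))) :
    SB 3 zS3 := h33364 3 zS3 linearIndependent_zS3 linLiouville_zS3 not_hyperLinLiouville_zS3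

/-- **THE LIVE ITEM 33364 APPLIED at `z⋆₃^π`.** -/
theorem item33364_at_zS3pi
    (h33364 : ∀ (n : ℕ) (z : Fin n → ℂ), LinearIndependent ℚ z →
      (∀ ω : ℕ, ∃ h : Fin n → ℤ, h ≠ 0 ∧ ‖∑ i, (h i : ℂ) * z i‖ < 1 / (1 + ∑ i, (|h i| : ℝ)) ^ ω) →
      (¬ ∀ m : ℕ, ∃ h : Fin n → ℤ, h ≠ 0 ∧
        ‖∑ i, (h i : ℂ) * z i‖ < Real.exp (-((1 + ∑ i, (|h i| : ℝ)) ^ m))) →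
      (n : Cardinal) ≤ Algebra.trdeg ℚ
        ↥(IntermediateField.adjoin ℚ (Set.range z ∪ Set.range (Complex.exp ∘ z)))) :
    SB 3 zS3pi := h33364 3 zS3pi linearIndependent_zS3pi linLiouville_zS3pi not_hyperLinLiouville_zS3pi

/-- **THE LIVE ITEM 31077 APPLIED at the pair `z⋆₂`** (its text as a hypothesis, binders verbatim). -/
theorem item31077_at_zS2
    (h31077 : ∀ (n : ℕ) (z : Fin n → ℂ), LinearIndependent ℚ z →
      (∃ w ∈ Submodule.span ℚ (Set.range z), Liouville w.re ∨ Liouville w.im) →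
      (n : Cardinal) ≤ Algebra.trdeg ℚ
        ↥(IntermediateField.adjoin ℚ (Set.range z ∪ Set.range (Complex.exp ∘ z)))) :
    SB 2 zS2 := h31077 2 zS2 linearIndependent_zS2 coordLiouvilleSpan_zS2

/-- **THE LIVE ITEM 31077 APPLIED at `z⋆₃`.** -/
theorem item31077_at_zS3
    (h31077 : ∀ (n : ℕ) (z : Fin n → ℂ), LinearIndependent ℚ z →
      (∃ w ∈ Submodule.span ℚ (Set.range z), Liouville w.re ∨ Liouville w.im) →
      (n : Cardinal) ≤ Algebra.trdeg ℚ
        ↥(IntermediateField.adjoin ℚ (Set.range z ∪ Set.range (Complex.exp ∘ z)))) :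
    SB 3 zS3 := h31077 3 zS3 linearIndependent_zS3 coordLiouvilleSpan_zS3

end Certificates

end Summit.Schanuel.Schanuel.Theorems.RootDecomp1KSkelCell
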